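import Literature.NumberTheory.EllipticCurves.TwoIsogenySelmerGroupRankProofs
import Literature.NumberTheory.EllipticCurves.Curve346SelmerCertificatesA
import Literature.NumberTheory.EllipticCurves.BinaryQuarticGoodReductionSolubilityProofs
import Literature.NumberTheory.DiophantineGeometry.LindMordellQuarticsHassePrincipleFailure
import Literature.NumberTheory.QuadraticForms.PadicSquares
import Mathlib.Tactic.Simproc.Factors
import HarnessLib

/-!
# `17` explicit everywhere-locally-soluble classes of the `2`-isogeny Selmer group `S(776, 147840)` of
# `X' : y² = x³ + 776x² + 147840x` — the homogeneous spaces `w² = d u⁴ + 776 u²z² + (147840/d) z⁴` without a rational point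
# that carry `Ш(X/ℚ)[φ]` for the rank-`2` curve `X = [0, -388, 0, 676, 0]` (Silverman, AEC X.4.9, X.6.5)

Topic `NumberTheory/EllipticCurves`. Second of three files (`Curve388RankDescent`, this, `Curve388NontrivialSha`). In the tree's vocabulary
`S'(-388, 676) = S(776, 147840)`; it has at most `2^{ω(147840)+1} = 64` classes, of which `16` are images of rational
points of `X'` (third file). Here `17` further classes `d ∈ {-1, 2, -2, 3, -5, 6, -6, -7, 10, -10, 11, -11, 14, -14, 15, 21, 22}` are shown
everywhere locally soluble by EXPLICIT LOCAL POINTS: a real point; a `ℚ₂`-point (a value `4^m·c`, `c ≡ 1 (mod 8)`, tree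
`padicInt_isSquare_of_toZModPow_three_eq_one`); `ℚ_q`-points at the odd primes `q ∣ Δ = 2 ^ 23 * 3 * 5 * 7 * 11 * 13 ^ 4` (values `q^{2m}·c`,
`c` a non-zero square mod `q`, tree `exists_sq_eq_intCast`); good reduction elsewhere (tree
`BinaryQuartic.isSoluble_padic_of_not_dvd_disc`, Bhargava–Shankar Prop. 5.13). With the `16` point classes this gives
`33 > 32` members, so `dim₂ S(776, 147840) = 6` (third file): ALL classes are everywhere locally soluble.

Everything is re-verified by the kernel (the local points were found by a plain search). Theorems only.

## References

* [SilvermanAEC2009] J. H. Silverman, *AEC*, 2nd ed.: Prop. X.4.9, proof of Prop. X.6.2(b), Prop. X.6.5(a).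
* [BhargavaShankarAnnals2015] M. Bhargava, A. Shankar, Ann. of Math. 181 (2015), Prop. 5.13.
-/

noncomputable section

open scoped Classical

namespace Literature.NumberTheory.EllipticCurves

namespace Curve388

open Literature.NumberTheory.DiophantineGeometry.LindMordellQuartics (exists_sq_eq_intCast)
open Literature.NumberTheory.QuadraticForms (padicInt_isSquare_of_toZModPow_three_eq_one)

/-! ## Local-point helpers for the quartics `⟨d, 0, 776, 0, e⟩` -/

/-- `Δ(⟨d, 0, 776, 0, e⟩) = 16·de·(776² − 4de)² = 276723023216640` for `de = 147840`. [cite: BhargavaShankarAnnals2015, §1.2 (discriminant formula)] -/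
theorem disc_C (d e : ℤ) (hde : d * e = 147840) : (twoIsogenyQuartic (776) d e).disc = 276723023216640 := by
  simp only [twoIsogenyQuartic, BinaryQuartic.disc]
  linear_combination (256 * ((d * e) ^ 2 + 147840 * (d * e) + 21856665600) - 128 * 602176 * (d * e + 147840) + 16 * 362615934976) * hde

/-- A prime dividing `276723023216640 = ±2 ^ 23 * 3 * 5 * 7 * 11 * 13 ^ 4` is one of `[2, 3, 5, 7, 11, 13]` (the primes of bad reduction of the quartics).
[cite: BhargavaShankarAnnals2015, Prop. 5.13 (the primes p ∣ Δ(f))] -/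
theorem prime_dvd_disc_cases {p : ℕ} (hp : p.Prime) (h : (p : ℤ) ∣ 276723023216640) : p = 2 ∨ p = 3 ∨ p = 5 ∨ p = 7 ∨ p = 11 ∨ p = 13 := by
  have habs : p ∣ 276723023216640 := by
    have := Int.natAbs_dvd_natAbs.mpr h
    simpa using this
  have h0 : p ∣ 2 ^ 23 * 3 * 5 * 7 * 11 * 13 ^ 4 := by
    rw [show (2 ^ 23 * 3 * 5 * 7 * 11 * 13 ^ 4 : ℕ) = 276723023216640 by norm_num]
    exact habs
  rcases (Nat.Prime.dvd_mul hp).mp h0 with h0l | hr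
  swap
  · exact Or.inr (Or.inr (Or.inr (Or.inr (Or.inr (((Nat.prime_dvd_prime_iff_eq hp (by norm_num : Nat.Prime 13)).mp (hp.dvd_of_dvd_pow hr)))))))
  rcases (Nat.Prime.dvd_mul hp).mp h0l with h0ll | hr
  swap
  · exact Or.inr (Or.inr (Or.inr (Or.inr (Or.inl ((Nat.prime_dvd_prime_iff_eq hp (by norm_num : Nat.Prime 11)).mp hr)))))
  rcases (Nat.Prime.dvd_mul hp).mp h0ll with h0lll | hr
  swap
  · exact Or.inr (Or.inr (Or.inr (Or.inl ((Nat.prime_dvd_prime_iff_eq hp (by norm_num : Nat.Prime 7)).mp hr))))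
  rcases (Nat.Prime.dvd_mul hp).mp h0lll with h0llll | hr
  swap
  · exact Or.inr (Or.inr (Or.inl ((Nat.prime_dvd_prime_iff_eq hp (by norm_num : Nat.Prime 5)).mp hr)))
  rcases (Nat.Prime.dvd_mul hp).mp h0llll with h0lllll | hr
  swap
  · exact Or.inr (Or.inl ((Nat.prime_dvd_prime_iff_eq hp (by norm_num : Nat.Prime 3)).mp hr))
  exact Or.inl ((Nat.prime_dvd_prime_iff_eq hp (by norm_num : Nat.Prime 2)).mp (hp.dvd_of_dvd_pow h0lllll))

/-- A prime not dividing `276723023216640` (which `2` and `3` divide) is at least `5`.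
[cite: BhargavaShankarAnnals2015, Prop. 5.13 (p ≥ 5 with p ∤ Δ)] -/
theorem five_le_of_not_dvd_disc {p : ℕ} (hp : p.Prime) (h : ¬ (p : ℤ) ∣ 276723023216640) : 5 ≤ p := by
  by_contra hlt
  push Not at hlt
  interval_cases p
  · exact absurd hp (by decide)
  · exact absurd hp (by decide)
  · exact h (by norm_num)
  · exact h (by norm_num)
  · exact absurd hp (by decide)

/-- A real point from a positive value: `f(u, z) = v > 0` gives `(u, z, √v)`.
[cite: SilvermanAEC2009, Prop. X.6.5(a) (real points of the homogeneous spaces)] -/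
theorem isSoluble_real_of_pos {d e u z v : ℤ} (huz : u ≠ 0 ∨ z ≠ 0) (hv : 0 < v)
    (hval : d * u ^ 4 + 776 * u ^ 2 * z ^ 2 + e * z ^ 4 = v) :
    ((twoIsogenyQuartic (776) d e).map (Int.castRingHom ℝ)).IsSoluble := by
  refine ⟨u, z, Real.sqrt v, ?_, ?_⟩
  · rcases huz with h | h
    · exact Or.inl (by exact_mod_cast h)
    · exact Or.inr (by exact_mod_cast h)
  · rw [eval_map_twoIsogenyQuartic, Real.sq_sqrt (by exact_mod_cast hv.le)]
    simp only [eq_intCast]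
    exact_mod_cast hval.symm

/-- A `ℚ_q`-point from a square root in `ℤ_q`: `f(u, z) = c·k²` with `r² = c` gives `(u, z, k r)`.
[cite: SilvermanAEC2009, proof of Prop. X.6.2(b) (local points by lifting square roots)] -/
theorem isSoluble_padic_of_sq {q : ℕ} [Fact q.Prime] {d e u z k c : ℤ} (huz : u ≠ 0 ∨ z ≠ 0)
    (hval : d * u ^ 4 + 776 * u ^ 2 * z ^ 2 + e * z ^ 4 = c * k ^ 2) {r : ℤ_[q]} (hr : r ^ 2 = c) :
    ((twoIsogenyQuartic (776) d e).map (Int.castRingHom ℚ_[q])).IsSoluble := by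
  refine ⟨u, z, (k : ℚ_[q]) * r, ?_, ?_⟩
  · rcases huz with h | h
    · exact Or.inl (by exact_mod_cast h)
    · exact Or.inr (by exact_mod_cast h)
  · have h := congrArg ((↑) : ℤ_[q] → ℚ_[q]) hr
    push_cast at h
    have hv : ((d * u ^ 4 + 776 * u ^ 2 * z ^ 2 + e * z ^ 4 : ℤ) : ℚ_[q]) = ((c * k ^ 2 : ℤ) : ℚ_[q]) := by
      rw [hval]
    push_cast at hv
    rw [eval_map_twoIsogenyQuartic, mul_pow, h]
    simp only [eq_intCast]
    linear_combination -hv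

/-- Squarefreeness of a (small) integer from the factorisation of its absolute value. [folklore] -/
private theorem squarefree_int_of_natAbs {d : ℤ} {n : ℕ} (h : d.natAbs = n) (hn : n ≠ 0)
    (hnd : n.primeFactorsList.Nodup) : Squarefree d :=
  Int.squarefree_natAbs.mp (h ▸ (Nat.squarefree_iff_nodup_primeFactorsList hn).mpr hnd)

/-! ## The certificates (first part) -/

/-- **`C_{-1} : w² = -1u⁴ + 776u²z² + (-147840)z⁴` is everywhere locally soluble**: real point `(19, 1)` (value `1975`); `ℚ₂`-point `(2, 1)` (value `4²·(-9047)`, `-9047 ≡ 1 (mod 8)`); `ℚ_{3}`-point `(1, 1)` (value `1²·(-147065)`, `≡ 1² (mod 3)`); `ℚ_{5}`-point `(1, 0)` (value `1²·(-1)`, `≡ 2² (mod 5)`); `ℚ_{7}`-point `(1, 2)` (value `1²·(-2362337)`, `≡ 3² (mod 7)`); `ℚ_{11}`-point `(1, 1)` (value `1²·(-147065)`, `≡ 4² (mod 11)`); `ℚ_{13}`-point `(0, 1)` (value `1²·(-147840)`, `≡ 3² (mod 13)`); good reduction at the other primes.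
[cite: SilvermanAEC2009, Prop. X.6.5(a) (the method: local points by Hensel's lemma)]
[cite: BhargavaShankarAnnals2015, Prop. 5.13 (good reduction implies local solubility)] -/
theorem isLocallySoluble_C_m1 : (twoIsogenyQuartic (776) (-1) (-147840)).IsLocallySoluble := by
  refine ⟨isSoluble_real_of_pos (u := 19) (z := 1) (v := 1975) (Or.inl (by norm_num)) (by norm_num) (by norm_num),
    fun p hp => ?_⟩
  have hP : p.Prime := hp.out
  by_cases hdvd : (p : ℤ) ∣ 276723023216640
  · rcases prime_dvd_disc_cases hP hdvd with rfl | rfl | rfl | rfl | rfl | rfl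
    · obtain ⟨r, hr⟩ := Curve346.exists_sq_eq_two (c := -9047) (by decide)
      exact isSoluble_padic_of_sq (u := 2) (z := 1) (k := 4) (Or.inl (by norm_num)) (by norm_num) hr
    · obtain ⟨r, hr⟩ := exists_sq_eq_intCast (q := 3) (by norm_num) (c := -147065) (w := 1) (by norm_num) (by norm_num)
      exact isSoluble_padic_of_sq (u := 1) (z := 1) (k := 1) (Or.inl (by norm_num)) (by norm_num) hr
    · obtain ⟨r, hr⟩ := exists_sq_eq_intCast (q := 5) (by norm_num) (c := -1) (w := 2) (by norm_num) (by norm_num)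
      exact isSoluble_padic_of_sq (u := 1) (z := 0) (k := 1) (Or.inl (by norm_num)) (by norm_num) hr
    · obtain ⟨r, hr⟩ := exists_sq_eq_intCast (q := 7) (by norm_num) (c := -2362337) (w := 3) (by norm_num) (by norm_num)
      exact isSoluble_padic_of_sq (u := 1) (z := 2) (k := 1) (Or.inl (by norm_num)) (by norm_num) hr
    · obtain ⟨r, hr⟩ := exists_sq_eq_intCast (q := 11) (by norm_num) (c := -147065) (w := 4) (by norm_num) (by norm_num)
      exact isSoluble_padic_of_sq (u := 1) (z := 1) (k := 1) (Or.inl (by norm_num)) (by norm_num) hr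
    · obtain ⟨r, hr⟩ := exists_sq_eq_intCast (q := 13) (by norm_num) (c := -147840) (w := 3) (by norm_num) (by norm_num)
      exact isSoluble_padic_of_sq (u := 0) (z := 1) (k := 1) (Or.inr (by norm_num)) (by norm_num) hr
  · exact BinaryQuartic.isSoluble_padic_of_not_dvd_disc (five_le_of_not_dvd_disc hP hdvd) _
      (by rw [disc_C (-1) (-147840) (by norm_num)]; exact hdvd)

/-- **`C_{2} : w² = 2u⁴ + 776u²z² + (73920)z⁴` is everywhere locally soluble**: real point `(0, 1)` (value `73920`); `ℚ₂`-point `(2, 5)` (value `32²·(45193)`, `45193 ≡ 1 (mod 8)`); `ℚ_{3}`-point `(1, 1)` (value `1²·(74698)`, `≡ 1² (mod 3)`); `ℚ_{5}`-point `(1, 2)` (value `1²·(1185826)`, `≡ 1² (mod 5)`); `ℚ_{7}`-point `(1, 0)` (value `1²·(2)`, `≡ 3² (mod 7)`); `ℚ_{11}`-point `(1, 2)` (value `1²·(1185826)`, `≡ 2² (mod 11)`); `ℚ_{13}`-point `(2, 11)` (value `13²·(6406144)`, `≡ 2² (mod 13)`); good reduction at the other primes.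
[cite: SilvermanAEC2009, Prop. X.6.5(a) (the method: local points by Hensel's lemma)]
[cite: BhargavaShankarAnnals2015, Prop. 5.13 (good reduction implies local solubility)] -/
theorem isLocallySoluble_C_2 : (twoIsogenyQuartic (776) (2) (73920)).IsLocallySoluble := by
  refine ⟨isSoluble_real_of_pos (u := 0) (z := 1) (v := 73920) (Or.inr (by norm_num)) (by norm_num) (by norm_num),
    fun p hp => ?_⟩
  have hP : p.Prime := hp.out
  by_cases hdvd : (p : ℤ) ∣ 276723023216640
  · rcases prime_dvd_disc_cases hP hdvd with rfl | rfl | rfl | rfl | rfl | rfl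
    · obtain ⟨r, hr⟩ := Curve346.exists_sq_eq_two (c := 45193) (by decide)
      exact isSoluble_padic_of_sq (u := 2) (z := 5) (k := 32) (Or.inl (by norm_num)) (by norm_num) hr
    · obtain ⟨r, hr⟩ := exists_sq_eq_intCast (q := 3) (by norm_num) (c := 74698) (w := 1) (by norm_num) (by norm_num)
      exact isSoluble_padic_of_sq (u := 1) (z := 1) (k := 1) (Or.inl (by norm_num)) (by norm_num) hr
    · obtain ⟨r, hr⟩ := exists_sq_eq_intCast (q := 5) (by norm_num) (c := 1185826) (w := 1) (by norm_num) (by norm_num)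
      exact isSoluble_padic_of_sq (u := 1) (z := 2) (k := 1) (Or.inl (by norm_num)) (by norm_num) hr
    · obtain ⟨r, hr⟩ := exists_sq_eq_intCast (q := 7) (by norm_num) (c := 2) (w := 3) (by norm_num) (by norm_num)
      exact isSoluble_padic_of_sq (u := 1) (z := 0) (k := 1) (Or.inl (by norm_num)) (by norm_num) hr
    · obtain ⟨r, hr⟩ := exists_sq_eq_intCast (q := 11) (by norm_num) (c := 1185826) (w := 2) (by norm_num) (by norm_num)
      exact isSoluble_padic_of_sq (u := 1) (z := 2) (k := 1) (Or.inl (by norm_num)) (by norm_num) hr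
    · obtain ⟨r, hr⟩ := exists_sq_eq_intCast (q := 13) (by norm_num) (c := 6406144) (w := 2) (by norm_num) (by norm_num)
      exact isSoluble_padic_of_sq (u := 2) (z := 11) (k := 13) (Or.inl (by norm_num)) (by norm_num) hr
  · exact BinaryQuartic.isSoluble_padic_of_not_dvd_disc (five_le_of_not_dvd_disc hP hdvd) _
      (by rw [disc_C (2) (73920) (by norm_num)]; exact hdvd)

/-- **`C_{-2} : w² = -2u⁴ + 776u²z² + (-73920)z⁴` is everywhere locally soluble**: real point `(13, 1)` (value `102`); `ℚ₂`-point `(2, 3)` (value `8²·(-93119)`, `-93119 ≡ 1 (mod 8)`); `ℚ_{3}`-point `(1, 0)` (value `1²·(-2)`, `≡ 1² (mod 3)`); `ℚ_{5}`-point `(1, 1)` (value `1²·(-73146)`, `≡ 2² (mod 5)`); `ℚ_{7}`-point `(1, 1)` (value `1²·(-73146)`, `≡ 2² (mod 7)`); `ℚ_{11}`-point `(1, 0)` (value `1²·(-2)`, `≡ 3² (mod 11)`); `ℚ_{13}`-point `(3, 2)` (value `13²·(-6834)`, `≡ 2² (mod 13)`); good reduction at the other primes.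
[cite: SilvermanAEC2009, Prop. X.6.5(a) (the method: local points by Hensel's lemma)]
[cite: BhargavaShankarAnnals2015, Prop. 5.13 (good reduction implies local solubility)] -/
theorem isLocallySoluble_C_m2 : (twoIsogenyQuartic (776) (-2) (-73920)).IsLocallySoluble := by
  refine ⟨isSoluble_real_of_pos (u := 13) (z := 1) (v := 102) (Or.inl (by norm_num)) (by norm_num) (by norm_num),
    fun p hp => ?_⟩
  have hP : p.Prime := hp.out
  by_cases hdvd : (p : ℤ) ∣ 276723023216640
  · rcases prime_dvd_disc_cases hP hdvd with rfl | rfl | rfl | rfl | rfl | rfl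
    · obtain ⟨r, hr⟩ := Curve346.exists_sq_eq_two (c := -93119) (by decide)
      exact isSoluble_padic_of_sq (u := 2) (z := 3) (k := 8) (Or.inl (by norm_num)) (by norm_num) hr
    · obtain ⟨r, hr⟩ := exists_sq_eq_intCast (q := 3) (by norm_num) (c := -2) (w := 1) (by norm_num) (by norm_num)
      exact isSoluble_padic_of_sq (u := 1) (z := 0) (k := 1) (Or.inl (by norm_num)) (by norm_num) hr
    · obtain ⟨r, hr⟩ := exists_sq_eq_intCast (q := 5) (by norm_num) (c := -73146) (w := 2) (by norm_num) (by norm_num)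
      exact isSoluble_padic_of_sq (u := 1) (z := 1) (k := 1) (Or.inl (by norm_num)) (by norm_num) hr
    · obtain ⟨r, hr⟩ := exists_sq_eq_intCast (q := 7) (by norm_num) (c := -73146) (w := 2) (by norm_num) (by norm_num)
      exact isSoluble_padic_of_sq (u := 1) (z := 1) (k := 1) (Or.inl (by norm_num)) (by norm_num) hr
    · obtain ⟨r, hr⟩ := exists_sq_eq_intCast (q := 11) (by norm_num) (c := -2) (w := 3) (by norm_num) (by norm_num)
      exact isSoluble_padic_of_sq (u := 1) (z := 0) (k := 1) (Or.inl (by norm_num)) (by norm_num) hr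
    · obtain ⟨r, hr⟩ := exists_sq_eq_intCast (q := 13) (by norm_num) (c := -6834) (w := 2) (by norm_num) (by norm_num)
      exact isSoluble_padic_of_sq (u := 3) (z := 2) (k := 13) (Or.inl (by norm_num)) (by norm_num) hr
  · exact BinaryQuartic.isSoluble_padic_of_not_dvd_disc (five_le_of_not_dvd_disc hP hdvd) _
      (by rw [disc_C (-2) (-73920) (by norm_num)]; exact hdvd)

/-- **`C_{3} : w² = 3u⁴ + 776u²z² + (49280)z⁴` is everywhere locally soluble**: real point `(0, 1)` (value `49280`); `ℚ₂`-point `(4, 13)` (value `64²·(344137)`, `344137 ≡ 1 (mod 8)`); `ℚ_{3}`-point `(1, 1)` (value `1²·(50059)`, `≡ 1² (mod 3)`); `ℚ_{5}`-point `(1, 1)` (value `1²·(50059)`, `≡ 2² (mod 5)`); `ℚ_{7}`-point `(1, 1)` (value `1²·(50059)`, `≡ 3² (mod 7)`); `ℚ_{11}`-point `(1, 0)` (value `1²·(3)`, `≡ 5² (mod 11)`); `ℚ_{13}`-point `(0, 1)` (value `1²·(49280)`, `≡ 6² (mod 13)`); good reduction at the other primes.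
[cite: SilvermanAEC2009, Prop. X.6.5(a) (the method: local points by Hensel's lemma)]
[cite: BhargavaShankarAnnals2015, Prop. 5.13 (good reduction implies local solubility)] -/
theorem isLocallySoluble_C_3 : (twoIsogenyQuartic (776) (3) (49280)).IsLocallySoluble := by
  refine ⟨isSoluble_real_of_pos (u := 0) (z := 1) (v := 49280) (Or.inr (by norm_num)) (by norm_num) (by norm_num),
    fun p hp => ?_⟩
  have hP : p.Prime := hp.out
  by_cases hdvd : (p : ℤ) ∣ 276723023216640
  · rcases prime_dvd_disc_cases hP hdvd with rfl | rfl | rfl | rfl | rfl | rfl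
    · obtain ⟨r, hr⟩ := Curve346.exists_sq_eq_two (c := 344137) (by decide)
      exact isSoluble_padic_of_sq (u := 4) (z := 13) (k := 64) (Or.inl (by norm_num)) (by norm_num) hr
    · obtain ⟨r, hr⟩ := exists_sq_eq_intCast (q := 3) (by norm_num) (c := 50059) (w := 1) (by norm_num) (by norm_num)
      exact isSoluble_padic_of_sq (u := 1) (z := 1) (k := 1) (Or.inl (by norm_num)) (by norm_num) hr
    · obtain ⟨r, hr⟩ := exists_sq_eq_intCast (q := 5) (by norm_num) (c := 50059) (w := 2) (by norm_num) (by norm_num)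
      exact isSoluble_padic_of_sq (u := 1) (z := 1) (k := 1) (Or.inl (by norm_num)) (by norm_num) hr
    · obtain ⟨r, hr⟩ := exists_sq_eq_intCast (q := 7) (by norm_num) (c := 50059) (w := 3) (by norm_num) (by norm_num)
      exact isSoluble_padic_of_sq (u := 1) (z := 1) (k := 1) (Or.inl (by norm_num)) (by norm_num) hr
    · obtain ⟨r, hr⟩ := exists_sq_eq_intCast (q := 11) (by norm_num) (c := 3) (w := 5) (by norm_num) (by norm_num)
      exact isSoluble_padic_of_sq (u := 1) (z := 0) (k := 1) (Or.inl (by norm_num)) (by norm_num) hr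
    · obtain ⟨r, hr⟩ := exists_sq_eq_intCast (q := 13) (by norm_num) (c := 49280) (w := 6) (by norm_num) (by norm_num)
      exact isSoluble_padic_of_sq (u := 0) (z := 1) (k := 1) (Or.inr (by norm_num)) (by norm_num) hr
  · exact BinaryQuartic.isSoluble_padic_of_not_dvd_disc (five_le_of_not_dvd_disc hP hdvd) _
      (by rw [disc_C (3) (49280) (by norm_num)]; exact hdvd)

/-- **`C_{-5} : w² = -5u⁴ + 776u²z² + (-29568)z⁴` is everywhere locally soluble**: real point `(9, 1)` (value `483`); `ℚ₂`-point `(4, 3)` (value `32²·(-2231)`, `-2231 ≡ 1 (mod 8)`); `ℚ_{3}`-point `(1, 0)` (value `1²·(-5)`, `≡ 1² (mod 3)`); `ℚ_{5}`-point `(1, 2)` (value `1²·(-469989)`, `≡ 1² (mod 5)`); `ℚ_{7}`-point `(1, 0)` (value `1²·(-5)`, `≡ 3² (mod 7)`); `ℚ_{11}`-point `(1, 1)` (value `1²·(-28797)`, `≡ 1² (mod 11)`); `ℚ_{13}`-point `(1, 2)` (value `13²·(-2781)`, `≡ 1² (mod 13)`); good reduction at the other primes.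
[cite: SilvermanAEC2009, Prop. X.6.5(a) (the method: local points by Hensel's lemma)]
[cite: BhargavaShankarAnnals2015, Prop. 5.13 (good reduction implies local solubility)] -/
theorem isLocallySoluble_C_m5 : (twoIsogenyQuartic (776) (-5) (-29568)).IsLocallySoluble := by
  refine ⟨isSoluble_real_of_pos (u := 9) (z := 1) (v := 483) (Or.inl (by norm_num)) (by norm_num) (by norm_num),
    fun p hp => ?_⟩
  have hP : p.Prime := hp.out
  by_cases hdvd : (p : ℤ) ∣ 276723023216640
  · rcases prime_dvd_disc_cases hP hdvd with rfl | rfl | rfl | rfl | rfl | rfl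
    · obtain ⟨r, hr⟩ := Curve346.exists_sq_eq_two (c := -2231) (by decide)
      exact isSoluble_padic_of_sq (u := 4) (z := 3) (k := 32) (Or.inl (by norm_num)) (by norm_num) hr
    · obtain ⟨r, hr⟩ := exists_sq_eq_intCast (q := 3) (by norm_num) (c := -5) (w := 1) (by norm_num) (by norm_num)
      exact isSoluble_padic_of_sq (u := 1) (z := 0) (k := 1) (Or.inl (by norm_num)) (by norm_num) hr
    · obtain ⟨r, hr⟩ := exists_sq_eq_intCast (q := 5) (by norm_num) (c := -469989) (w := 1) (by norm_num) (by norm_num)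
      exact isSoluble_padic_of_sq (u := 1) (z := 2) (k := 1) (Or.inl (by norm_num)) (by norm_num) hr
    · obtain ⟨r, hr⟩ := exists_sq_eq_intCast (q := 7) (by norm_num) (c := -5) (w := 3) (by norm_num) (by norm_num)
      exact isSoluble_padic_of_sq (u := 1) (z := 0) (k := 1) (Or.inl (by norm_num)) (by norm_num) hr
    · obtain ⟨r, hr⟩ := exists_sq_eq_intCast (q := 11) (by norm_num) (c := -28797) (w := 1) (by norm_num) (by norm_num)
      exact isSoluble_padic_of_sq (u := 1) (z := 1) (k := 1) (Or.inl (by norm_num)) (by norm_num) hr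
    · obtain ⟨r, hr⟩ := exists_sq_eq_intCast (q := 13) (by norm_num) (c := -2781) (w := 1) (by norm_num) (by norm_num)
      exact isSoluble_padic_of_sq (u := 1) (z := 2) (k := 13) (Or.inl (by norm_num)) (by norm_num) hr
  · exact BinaryQuartic.isSoluble_padic_of_not_dvd_disc (five_le_of_not_dvd_disc hP hdvd) _
      (by rw [disc_C (-5) (-29568) (by norm_num)]; exact hdvd)

/-- **`C_{6} : w² = 6u⁴ + 776u²z² + (24640)z⁴` is everywhere locally soluble**: real point `(0, 1)` (value `24640`); `ℚ₂`-point `(0, 1)` (value `8²·(385)`, `385 ≡ 1 (mod 8)`); `ℚ_{3}`-point `(0, 1)` (value `1²·(24640)`, `≡ 1² (mod 3)`); `ℚ_{5}`-point `(1, 0)` (value `1²·(6)`, `≡ 1² (mod 5)`); `ℚ_{7}`-point `(1, 2)` (value `1²·(397350)`, `≡ 3² (mod 7)`); `ℚ_{11}`-point `(1, 1)` (value `1²·(25422)`, `≡ 1² (mod 11)`); `ℚ_{13}`-point `(1, 4)` (value `13²·(37398)`, `≡ 6² (mod 13)`); good reduction at the other primes.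
[cite: SilvermanAEC2009, Prop. X.6.5(a) (the method: local points by Hensel's lemma)]
[cite: BhargavaShankarAnnals2015, Prop. 5.13 (good reduction implies local solubility)] -/
theorem isLocallySoluble_C_6 : (twoIsogenyQuartic (776) (6) (24640)).IsLocallySoluble := by
  refine ⟨isSoluble_real_of_pos (u := 0) (z := 1) (v := 24640) (Or.inr (by norm_num)) (by norm_num) (by norm_num),
    fun p hp => ?_⟩
  have hP : p.Prime := hp.out
  by_cases hdvd : (p : ℤ) ∣ 276723023216640
  · rcases prime_dvd_disc_cases hP hdvd with rfl | rfl | rfl | rfl | rfl | rfl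
    · obtain ⟨r, hr⟩ := Curve346.exists_sq_eq_two (c := 385) (by decide)
      exact isSoluble_padic_of_sq (u := 0) (z := 1) (k := 8) (Or.inr (by norm_num)) (by norm_num) hr
    · obtain ⟨r, hr⟩ := exists_sq_eq_intCast (q := 3) (by norm_num) (c := 24640) (w := 1) (by norm_num) (by norm_num)
      exact isSoluble_padic_of_sq (u := 0) (z := 1) (k := 1) (Or.inr (by norm_num)) (by norm_num) hr
    · obtain ⟨r, hr⟩ := exists_sq_eq_intCast (q := 5) (by norm_num) (c := 6) (w := 1) (by norm_num) (by norm_num)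
      exact isSoluble_padic_of_sq (u := 1) (z := 0) (k := 1) (Or.inl (by norm_num)) (by norm_num) hr
    · obtain ⟨r, hr⟩ := exists_sq_eq_intCast (q := 7) (by norm_num) (c := 397350) (w := 3) (by norm_num) (by norm_num)
      exact isSoluble_padic_of_sq (u := 1) (z := 2) (k := 1) (Or.inl (by norm_num)) (by norm_num) hr
    · obtain ⟨r, hr⟩ := exists_sq_eq_intCast (q := 11) (by norm_num) (c := 25422) (w := 1) (by norm_num) (by norm_num)
      exact isSoluble_padic_of_sq (u := 1) (z := 1) (k := 1) (Or.inl (by norm_num)) (by norm_num) hr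
    · obtain ⟨r, hr⟩ := exists_sq_eq_intCast (q := 13) (by norm_num) (c := 37398) (w := 6) (by norm_num) (by norm_num)
      exact isSoluble_padic_of_sq (u := 1) (z := 4) (k := 13) (Or.inl (by norm_num)) (by norm_num) hr
  · exact BinaryQuartic.isSoluble_padic_of_not_dvd_disc (five_le_of_not_dvd_disc hP hdvd) _
      (by rw [disc_C (6) (24640) (by norm_num)]; exact hdvd)

/-- **`C_{-6} : w² = -6u⁴ + 776u²z² + (-24640)z⁴` is everywhere locally soluble**: real point `(8, 1)` (value `448`); `ℚ₂`-point `(4, 1)` (value `8²·(-215)`, `-215 ≡ 1 (mod 8)`); `ℚ_{3}`-point `(1, 1)` (value `1²·(-23870)`, `≡ 1² (mod 3)`); `ℚ_{5}`-point `(1, 0)` (value `1²·(-6)`, `≡ 2² (mod 5)`); `ℚ_{7}`-point `(1, 0)` (value `1²·(-6)`, `≡ 1² (mod 7)`); `ℚ_{11}`-point `(1, 0)` (value `1²·(-6)`, `≡ 4² (mod 11)`); `ℚ_{13}`-point `(1, 6)` (value `13²·(-188790)`, `≡ 3² (mod 13)`); good reduction at the other primes.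
[cite: SilvermanAEC2009, Prop. X.6.5(a) (the method: local points by Hensel's lemma)]
[cite: BhargavaShankarAnnals2015, Prop. 5.13 (good reduction implies local solubility)] -/
theorem isLocallySoluble_C_m6 : (twoIsogenyQuartic (776) (-6) (-24640)).IsLocallySoluble := by
  refine ⟨isSoluble_real_of_pos (u := 8) (z := 1) (v := 448) (Or.inl (by norm_num)) (by norm_num) (by norm_num),
    fun p hp => ?_⟩
  have hP : p.Prime := hp.out
  by_cases hdvd : (p : ℤ) ∣ 276723023216640
  · rcases prime_dvd_disc_cases hP hdvd with rfl | rfl | rfl | rfl | rfl | rfl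
    · obtain ⟨r, hr⟩ := Curve346.exists_sq_eq_two (c := -215) (by decide)
      exact isSoluble_padic_of_sq (u := 4) (z := 1) (k := 8) (Or.inl (by norm_num)) (by norm_num) hr
    · obtain ⟨r, hr⟩ := exists_sq_eq_intCast (q := 3) (by norm_num) (c := -23870) (w := 1) (by norm_num) (by norm_num)
      exact isSoluble_padic_of_sq (u := 1) (z := 1) (k := 1) (Or.inl (by norm_num)) (by norm_num) hr
    · obtain ⟨r, hr⟩ := exists_sq_eq_intCast (q := 5) (by norm_num) (c := -6) (w := 2) (by norm_num) (by norm_num)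
      exact isSoluble_padic_of_sq (u := 1) (z := 0) (k := 1) (Or.inl (by norm_num)) (by norm_num) hr
    · obtain ⟨r, hr⟩ := exists_sq_eq_intCast (q := 7) (by norm_num) (c := -6) (w := 1) (by norm_num) (by norm_num)
      exact isSoluble_padic_of_sq (u := 1) (z := 0) (k := 1) (Or.inl (by norm_num)) (by norm_num) hr
    · obtain ⟨r, hr⟩ := exists_sq_eq_intCast (q := 11) (by norm_num) (c := -6) (w := 4) (by norm_num) (by norm_num)
      exact isSoluble_padic_of_sq (u := 1) (z := 0) (k := 1) (Or.inl (by norm_num)) (by norm_num) hr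
    · obtain ⟨r, hr⟩ := exists_sq_eq_intCast (q := 13) (by norm_num) (c := -188790) (w := 3) (by norm_num) (by norm_num)
      exact isSoluble_padic_of_sq (u := 1) (z := 6) (k := 13) (Or.inl (by norm_num)) (by norm_num) hr
  · exact BinaryQuartic.isSoluble_padic_of_not_dvd_disc (five_le_of_not_dvd_disc hP hdvd) _
      (by rw [disc_C (-6) (-24640) (by norm_num)]; exact hdvd)

/-- **`C_{-7} : w² = -7u⁴ + 776u²z² + (-21120)z⁴` is everywhere locally soluble**: real point `(7, 1)` (value `97`); `ℚ₂`-point `(1, 0)` (value `1²·(-7)`, `-7 ≡ 1 (mod 8)`); `ℚ_{3}`-point `(1, 1)` (value `1²·(-20351)`, `≡ 1² (mod 3)`); `ℚ_{5}`-point `(1, 1)` (value `1²·(-20351)`, `≡ 2² (mod 5)`); `ℚ_{7}`-point `(1, 2)` (value `1²·(-334823)`, `≡ 1² (mod 7)`); `ℚ_{11}`-point `(1, 0)` (value `1²·(-7)`, `≡ 2² (mod 11)`); `ℚ_{13}`-point `(3, 1)` (value `13²·(-87)`, `≡ 2² (mod 13)`); good reduction at the other primes.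
[cite: SilvermanAEC2009, Prop. X.6.5(a) (the method: local points by Hensel's lemma)]
[cite: BhargavaShankarAnnals2015, Prop. 5.13 (good reduction implies local solubility)] -/
theorem isLocallySoluble_C_m7 : (twoIsogenyQuartic (776) (-7) (-21120)).IsLocallySoluble := by
  refine ⟨isSoluble_real_of_pos (u := 7) (z := 1) (v := 97) (Or.inl (by norm_num)) (by norm_num) (by norm_num),
    fun p hp => ?_⟩
  have hP : p.Prime := hp.out
  by_cases hdvd : (p : ℤ) ∣ 276723023216640
  · rcases prime_dvd_disc_cases hP hdvd with rfl | rfl | rfl | rfl | rfl | rfl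
    · obtain ⟨r, hr⟩ := Curve346.exists_sq_eq_two (c := -7) (by decide)
      exact isSoluble_padic_of_sq (u := 1) (z := 0) (k := 1) (Or.inl (by norm_num)) (by norm_num) hr
    · obtain ⟨r, hr⟩ := exists_sq_eq_intCast (q := 3) (by norm_num) (c := -20351) (w := 1) (by norm_num) (by norm_num)
      exact isSoluble_padic_of_sq (u := 1) (z := 1) (k := 1) (Or.inl (by norm_num)) (by norm_num) hr
    · obtain ⟨r, hr⟩ := exists_sq_eq_intCast (q := 5) (by norm_num) (c := -20351) (w := 2) (by norm_num) (by norm_num)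
      exact isSoluble_padic_of_sq (u := 1) (z := 1) (k := 1) (Or.inl (by norm_num)) (by norm_num) hr
    · obtain ⟨r, hr⟩ := exists_sq_eq_intCast (q := 7) (by norm_num) (c := -334823) (w := 1) (by norm_num) (by norm_num)
      exact isSoluble_padic_of_sq (u := 1) (z := 2) (k := 1) (Or.inl (by norm_num)) (by norm_num) hr
    · obtain ⟨r, hr⟩ := exists_sq_eq_intCast (q := 11) (by norm_num) (c := -7) (w := 2) (by norm_num) (by norm_num)
      exact isSoluble_padic_of_sq (u := 1) (z := 0) (k := 1) (Or.inl (by norm_num)) (by norm_num) hr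
    · obtain ⟨r, hr⟩ := exists_sq_eq_intCast (q := 13) (by norm_num) (c := -87) (w := 2) (by norm_num) (by norm_num)
      exact isSoluble_padic_of_sq (u := 3) (z := 1) (k := 13) (Or.inl (by norm_num)) (by norm_num) hr
  · exact BinaryQuartic.isSoluble_padic_of_not_dvd_disc (five_le_of_not_dvd_disc hP hdvd) _
      (by rw [disc_C (-7) (-21120) (by norm_num)]; exact hdvd)

/-- `-1 ∈ S(776, 147840)`. [cite: SilvermanAEC2009, Prop. X.4.9] -/
theorem mem_S_m1 : (-1 : ℤ) ∈ twoIsogenySelmerGroup (776) (147840) :=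
  (mem_twoIsogenySelmerGroup_iff (by norm_num)).mpr
    ⟨squarefree_int_of_natAbs (n := 1) rfl (by norm_num) (by simp), by norm_num,
      by rw [show (147840 : ℤ) / -1 = -147840 by norm_num]; exact isLocallySoluble_C_m1⟩

/-- `2 ∈ S(776, 147840)`. [cite: SilvermanAEC2009, Prop. X.4.9] -/
theorem mem_S_2 : (2 : ℤ) ∈ twoIsogenySelmerGroup (776) (147840) :=
  (mem_twoIsogenySelmerGroup_iff (by norm_num)).mpr
    ⟨squarefree_int_of_natAbs (n := 2) rfl (by norm_num) (by simp), by norm_num,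
      by rw [show (147840 : ℤ) / 2 = 73920 by norm_num]; exact isLocallySoluble_C_2⟩

/-- `-2 ∈ S(776, 147840)`. [cite: SilvermanAEC2009, Prop. X.4.9] -/
theorem mem_S_m2 : (-2 : ℤ) ∈ twoIsogenySelmerGroup (776) (147840) :=
  (mem_twoIsogenySelmerGroup_iff (by norm_num)).mpr
    ⟨squarefree_int_of_natAbs (n := 2) rfl (by norm_num) (by simp), by norm_num,
      by rw [show (147840 : ℤ) / -2 = -73920 by norm_num]; exact isLocallySoluble_C_m2⟩

/-- `3 ∈ S(776, 147840)`. [cite: SilvermanAEC2009, Prop. X.4.9] -/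
theorem mem_S_3 : (3 : ℤ) ∈ twoIsogenySelmerGroup (776) (147840) :=
  (mem_twoIsogenySelmerGroup_iff (by norm_num)).mpr
    ⟨squarefree_int_of_natAbs (n := 3) rfl (by norm_num) (by simp), by norm_num,
      by rw [show (147840 : ℤ) / 3 = 49280 by norm_num]; exact isLocallySoluble_C_3⟩

/-- `-5 ∈ S(776, 147840)`. [cite: SilvermanAEC2009, Prop. X.4.9] -/
theorem mem_S_m5 : (-5 : ℤ) ∈ twoIsogenySelmerGroup (776) (147840) :=
  (mem_twoIsogenySelmerGroup_iff (by norm_num)).mpr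
    ⟨squarefree_int_of_natAbs (n := 5) rfl (by norm_num) (by simp), by norm_num,
      by rw [show (147840 : ℤ) / -5 = -29568 by norm_num]; exact isLocallySoluble_C_m5⟩

/-- `6 ∈ S(776, 147840)`. [cite: SilvermanAEC2009, Prop. X.4.9] -/
theorem mem_S_6 : (6 : ℤ) ∈ twoIsogenySelmerGroup (776) (147840) :=
  (mem_twoIsogenySelmerGroup_iff (by norm_num)).mpr
    ⟨squarefree_int_of_natAbs (n := 6) rfl (by norm_num) (by simp), by norm_num,
      by rw [show (147840 : ℤ) / 6 = 24640 by norm_num]; exact isLocallySoluble_C_6⟩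

/-- `-6 ∈ S(776, 147840)`. [cite: SilvermanAEC2009, Prop. X.4.9] -/
theorem mem_S_m6 : (-6 : ℤ) ∈ twoIsogenySelmerGroup (776) (147840) :=
  (mem_twoIsogenySelmerGroup_iff (by norm_num)).mpr
    ⟨squarefree_int_of_natAbs (n := 6) rfl (by norm_num) (by simp), by norm_num,
      by rw [show (147840 : ℤ) / -6 = -24640 by norm_num]; exact isLocallySoluble_C_m6⟩

/-- `-7 ∈ S(776, 147840)`. [cite: SilvermanAEC2009, Prop. X.4.9] -/
theorem mem_S_m7 : (-7 : ℤ) ∈ twoIsogenySelmerGroup (776) (147840) :=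
  (mem_twoIsogenySelmerGroup_iff (by norm_num)).mpr
    ⟨squarefree_int_of_natAbs (n := 7) rfl (by norm_num) (by simp), by norm_num,
      by rw [show (147840 : ℤ) / -7 = -21120 by norm_num]; exact isLocallySoluble_C_m7⟩

end Curve388

end Literature.NumberTheory.EllipticCurves

end
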